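import Summits.FinalStateConjecture.FinalStateConjecture.Theorems.ClusterCompletenessOmegaLimitMultiKerrUniformRecurrence
import Summits.FinalStateConjecture.FinalStateConjecture.Theorems.ClusterCompletenessOmegaLimitMultiKerrStarHoleDictionary
import HarnessLib

/-!
# Route ClusterCompleteness · crux `OmegaLimitMultiKerr` — uniformly recurrent dark limits of a
# tame star hole chart (Birkhoff recurrence in crux currency)

Structure lemma for the crux stmt-FinalStateConjecture-14664 (`ClusterCompleteness.OmegaLimitMultiKerr`),
line `Sketch`, lead gen 6 (registered main theorem `exists_uniformlyRecurrent_starHole_omegaLimit`).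

`…UniformRecurrence` proved, in the abstract `Cᵏ_loc`-translate currency, that a TAME field has a
uniformly recurrent (Birkhoff almost-periodic) ω-limit. This file instantiates it for the objects of
the crux: a smooth hole chart `Ψ` of a spacetime `𝓢` on the horizon-penetrating STAR background
`starBackground Λ c M a (r_a ∘ Λ⁻¹(· − c))` (domain `{r > max M 0}`, invariant under the Killing
translation `e = Λ∂₀`, star time shifted and radius preserved along it), with star deviation
`dev★ = Ψ^* g − g_{M,a,Λ,c}` TAME after the chart time `τ₀` (finite `C^{k+1}` sup norms on the star
truncated late regions `{t* > τ₀, r ≤ R}` — the tameness clause of the recommended re-line's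
generic stub).

* `tame_translate_of_bounded_truncLateRegion` — the bridge used by every instantiation: on a model
  background with a translation vector (domain invariant, time shifted, radius preserved, both
  continuous), bounds on the truncated late regions give the abstract tameness hypothesis "on every
  compact `K` of the domain the derivatives are bounded at all translates `z + t • e`, `t ≥ a`";
* `exists_uniformlyRecurrent_starHole_omegaLimit` (registered) — SOME `Cᵏ_loc` ω-limit `g` of the
  star deviation translates is UNIFORMLY RECURRENT in Kerr-star time: for every compact `K` of the
  star domain and `ε > 0` the return times `{s | ‖g (· + s • Λ∂₀) − g‖_{Cᵏ(K)} < ε}` are relatively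
  dense in `ℝ`.

Reading: among the dark limits of a tame hole chart of a non-settling development there is always an
ALMOST-PERIODIC eternal one; combined with gens 3–5 (it is a `Cᵏ` field on the whole star tube,
eternal, bounded, anchored, and — where a metric — Ricci-flat), the stationarity input of the
LaSalle re-line may be taken to be the rigidity statement "almost-periodic tame anchored eternal
vacuum ends are stationary" (the almost-periodic extension of Bičák–Scholtz–Tod 2010 /
Alexakis–Schlue 2018). Birkhoff 1927, Ch. VII; Hale 1980, Ch. I §8. Everything is proved; Mathlib +
landed `Theorems` files only, no definitions.
-/

-- every `Summit.FinalStateConjecture.FinalStateConjecture.…` name repeats the summit = sub-problem segment (D-0017 layout)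
set_option linter.dupNamespace false

noncomputable section

open Set Filter Topology Function
open scoped Manifold ContDiff Topology ENNReal

namespace Summit.FinalStateConjecture.FinalStateConjecture.Theorems.ClusterCompleteness

open Literature.Geometry.Lorentzian

/-- **Bounds on the truncated late regions are tameness along the translation.** Let `B` be a model
background whose domain is invariant under `x ↦ x + s • e`, with `B.time (x + s • e) = B.time x + s`,
`B.radius (x + s • e) = B.radius x`, both continuous, and let `h` have derivatives of order `≤ m`
bounded on every truncated late region `{t > τ₀, r ≤ R}` (bound depending on `R`). Then on every
compact subset `K` of the domain the derivatives of order `≤ m` of `h` are bounded at all translates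
`z + t • e`, `z ∈ K`, `t ≥ a` (with `a = τ₀ − min_K t + 1`, bound = that of the radius `max_K r`):
the abstract tameness hypothesis of `…TranslateCompactness` / `…UniqueLimitConvergence` /
`…UniformRecurrence`. [folklore] -/
theorem tame_translate_of_bounded_truncLateRegion {W : Type*} [NormedAddCommGroup W]
    [NormedSpace ℝ W] (B : ModelBackground) (e : E4)
    (hdom : ∀ x ∈ (B.domain : Set E4), ∀ s : ℝ, x + s • e ∈ (B.domain : Set E4))
    (htime : ∀ (x : E4) (s : ℝ), B.time (x + s • e) = B.time x + s)
    (hrad : ∀ (x : E4) (s : ℝ), B.radius (x + s • e) = B.radius x)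
    (htc : Continuous B.time) (hrc : Continuous B.radius) {m : ℕ} {h : E4 → W} {τ₀ : ℝ}
    (hb : ∀ R : ℝ, ∃ C : ℝ, ∀ i, i ≤ m →
      ∀ x ∈ Subtype.val '' B.truncLateRegion τ₀ R, ‖iteratedFDeriv ℝ i h x‖ ≤ C) :
    ∀ K ⊆ (B.domain : Set E4), IsCompact K → ∃ Λ a : ℝ, ∀ t : ℝ, a ≤ t → ∀ i, i ≤ m →
      ∀ z ∈ K, ‖iteratedFDeriv ℝ i h (z + t • e)‖ ≤ Λ := by
  intro K hKO hK
  obtain ⟨t₀, ht₀⟩ := hK.bddBelow_image htc.continuousOn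
  obtain ⟨R₀, hR₀⟩ := hK.bddAbove_image hrc.continuousOn
  obtain ⟨C, hC⟩ := hb R₀
  refine ⟨C, τ₀ - t₀ + 1, fun t ht i hi z hz ↦ ?_⟩
  refine hC i hi _ ⟨⟨z + t • e, hdom z (hKO hz) _⟩, ⟨?_, ?_⟩, rfl⟩
  · have h1 : t₀ ≤ B.time z := ht₀ (mem_image_of_mem _ hz)
    show τ₀ < B.time (z + t • e)
    rw [htime]
    linarith
  · have h2 : B.radius z ≤ R₀ := hR₀ (mem_image_of_mem _ hz)
    show B.radius (z + t • e) ≤ R₀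
    rwa [hrad]

/-- **Registered structure stub (crux stmt-FinalStateConjecture-14664, line `Sketch`, stub
`UniformRecurrenceStarHole`): a tame star hole chart has a uniformly recurrent dark limit.** Let
`Ψ` be a smooth chart of the spacetime `𝓢` on the star background
`starBackground Λ c M a (x ↦ r_a(Λ⁻¹(x − c)))`, whose star deviation
`dev★ = 𝓢.deviationExtend (starBackground …) Ψ` has finite `C^{k+1}` sup norm on every star
truncated late region `{t* > τ₀, r ≤ R}` (TAME). Then some `Cᵏ_loc` ω-limit `g` of the translates
`dev★ (· + Tₙ • Λ∂₀)` (a `Cᵏ` field on the star domain, limit along some `Tₙ → +∞` on every compact)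
is UNIFORMLY RECURRENT in Kerr-star time: for every compact `K` of the star domain and `ε > 0`
there is `L > 0` such that every interval `[t, t + L]` contains an `s` with
`supCkENorm K k (g (· + s • Λ∂₀) − g) < ε`. Instance of `exists_omegaLimit_uniformlyRecurrent`
(invariance `add_smul_mem_starBackground_domain`, smoothness `contDiffOn_deviationExtend_star`,
tameness `tame_translate_of_bounded_truncLateRegion` from the finite sup norms). Birkhoff 1927,
Ch. VII §§1–2; Hale 1980, Ch. I §8. Closed form. [cite: Hale1980, Ch. I §8 Thm. 8.1] -/
theorem exists_uniformlyRecurrent_starHole_omegaLimit :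
    ∀ (𝓢 : Spacetime 4) (Λ : lorentzGroup) (c : E4) (M a : ℝ)
      {Ψ : (starBackground Λ c M a fun x ↦ Kerr.radius a (poincareInv Λ c x)).domain → 𝓢.carrier},
      ContMDiff 𝓘(ℝ, E4) (𝓡 4) ∞ Ψ → ∀ {k : ℕ} {τ₀ : ℝ},
      (∀ R : ℝ, supCkENorm (Subtype.val ''
          (starBackground Λ c M a fun x ↦ Kerr.radius a (poincareInv Λ c x)).truncLateRegion τ₀ R)
        (k + 1) (𝓢.deviationExtend
          (starBackground Λ c M a fun x ↦ Kerr.radius a (poincareInv Λ c x)) Ψ) ≠ ⊤) →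
      ∃ g : E4 → E4 →L[ℝ] E4 →L[ℝ] ℝ,
        ContDiffOn ℝ k g
          ((starBackground Λ c M a fun x ↦ Kerr.radius a (poincareInv Λ c x)).domain : Set E4) ∧
        (∃ T : ℕ → ℝ, Tendsto T atTop atTop ∧
          ∀ K ⊆ ((starBackground Λ c M a fun x ↦ Kerr.radius a (poincareInv Λ c x)).domain :
              Set E4), IsCompact K →
            Tendsto (fun n ↦ supCkENorm K k (fun x ↦
              𝓢.deviationExtend (starBackground Λ c M a fun x ↦ Kerr.radius a (poincareInv Λ c x))
                Ψ (x + T n • (Λ : E4 ≃L[ℝ] E4) (EuclideanSpace.single (0 : Fin 4) (1 : ℝ))) -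
                g x)) atTop (𝓝 0)) ∧
        ∀ K ⊆ ((starBackground Λ c M a fun x ↦ Kerr.radius a (poincareInv Λ c x)).domain :
            Set E4), IsCompact K → ∀ ε : ℝ, 0 < ε → ∃ L : ℝ, 0 < L ∧ ∀ t : ℝ,
          ∃ s ∈ Icc t (t + L), supCkENorm K k (fun x ↦
            g (x + s • (Λ : E4 ≃L[ℝ] E4) (EuclideanSpace.single (0 : Fin 4) (1 : ℝ))) - g x) <
            ENNReal.ofReal ε := by
  intro 𝓢 Λ c M a Ψ hΨ k τ₀ hfin
  -- the star domain is open and invariant under the Killing translation `e = Λ∂₀`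
  have hO : IsOpen ((starBackground Λ c M a fun x ↦ Kerr.radius a (poincareInv Λ c x)).domain :
      Set E4) :=
    (starBackground Λ c M a fun x ↦ Kerr.radius a (poincareInv Λ c x)).domain.isOpen
  have hOe := add_smul_mem_starBackground_domain Λ c M a fun x ↦ Kerr.radius a (poincareInv Λ c x)
  -- the star deviation is `C^∞`, hence `C^{k+1}`, on the star domain
  have hsm := contDiffOn_deviationExtend_star 𝓢 hΨ
  have hh : ContDiffOn ℝ (k + 1)
      (𝓢.deviationExtend (starBackground Λ c M a fun x ↦ Kerr.radius a (poincareInv Λ c x)) Ψ)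
      ((starBackground Λ c M a fun x ↦ Kerr.radius a (poincareInv Λ c x)).domain : Set E4) :=
    hsm.of_le (by exact_mod_cast le_top)
  -- tameness along `e` from the finite sup norms on the star truncated late regions
  have hb : ∀ R : ℝ, ∃ C : ℝ, ∀ i, i ≤ k + 1 → ∀ x ∈ Subtype.val ''
      (starBackground Λ c M a fun x ↦ Kerr.radius a (poincareInv Λ c x)).truncLateRegion τ₀ R,
        ‖iteratedFDeriv ℝ i (𝓢.deviationExtend
          (starBackground Λ c M a fun x ↦ Kerr.radius a (poincareInv Λ c x)) Ψ) x‖ ≤ C :=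
    fun R ↦ ⟨_, fun _ hi _ hx ↦ norm_iteratedFDeriv_le_toReal_supCkENorm hi hx _ (hfin R)⟩
  have htame := tame_translate_of_bounded_truncLateRegion
    (starBackground Λ c M a fun x ↦ Kerr.radius a (poincareInv Λ c x))
    ((Λ : E4 ≃L[ℝ] E4) (EuclideanSpace.single (0 : Fin 4) (1 : ℝ))) hOe
    (KerrSchildChart.time_add_smul Λ c M a) (KerrSchildChart.radius_add_smul Λ c M a)
    ((PiLp.continuous_apply 2 _ 0).comp (continuous_poincareInv Λ c))
    ((Kerr.continuous_radius a).comp (continuous_poincareInv Λ c)) hb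
  exact exists_omegaLimit_uniformlyRecurrent hO hOe hh htame

end Summit.FinalStateConjecture.FinalStateConjecture.Theorems.ClusterCompleteness

end
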